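import Summits.AtomisticToContinuum.FouriersLaw.Theorems.AbelRegularity.Negative.LacunaryPulse
import Summits.AtomisticToContinuum.FouriersLaw.Theorems.CoercivePulseAbelRegularityAbelOfIntegrableNegPart
import Summits.AtomisticToContinuum.FouriersLaw.Theorems.CoercivePulseAbelRegularityFilterTransfer
import Summits.AtomisticToContinuum.FouriersLaw.Theorems.CoercivePulseAbelRegularityMonotoneAbelOfSignedMoment
import HarnessLib

/-!
# `AbelRegularity` / Negative: the lacunary pulse is not a tame filtered memory — for ANY causal filter

Support file (`--supports stmt-AtomisticToContinuum-15384`) of the crux disprover (cdisprove) of the crux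
`CoercivePulse.AbelRegularity` (stmt-AtomisticToContinuum-15384).  With the three analysis stubs of the picked line
`Sketch` now LANDED (`Sketch.stub_filterTransfer`, `Sketch.stub_abelOfIntegrableNegPart`,
`Sketch.stub_monotoneAbelOfSignedMoment`) and the lacunary pulse of `Negative/LacunaryPulse.lean`, the line's open
physics stub S5 (`stub_tameFilteredMemory`) meets its recorded failure mode as a THEOREM:

* `not_abelDichotomy_lacunaryPulse` — the Abel means of the lacunary pulse
  `F(t) = Σₖ ρᵏ(e^{-ρᵏ|t|} − 2⁻⁸e^{-ρᵏ|t|/256})`, `ρ = 2⁻¹⁶`, neither converge in `ℝ` nor tend to `+∞` (named form of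
  the oscillation proved inside `exists_memory_abelMeans_oscillate`);
* `lacunaryPulse_not_tame` — **for EVERY causal filter** (`ψ` continuous, `ψ ≥ 0`, `U ≥ 0`, `∫_{[0,U]}ψ > 0`) the
  filtered pulse `F^ψ(t) = ∫_{[0,U]}ψ(u)F(t+u)du` is NOT tame: its negative part is NOT integrable on `(0,∞)` AND every
  iterated first moment `W_k[F^ψ](t) = ∫₀ᵗ(t−s)ᵏ·sF^ψ(s)ds` takes BOTH a negative and a positive value beyond every
  `t₀` — i.e. the conclusion of S5 FAILS verbatim for the pulse (by the landed S2–S4, exactly as in the line's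
  composition `AbelRegularity_of`, run contrapositively);
* `lacunaryPulse_negPart_not_integrable` — in particular (no filter) the pulse's anticorrelation has infinite area.

Reading for the provers: S5 cannot be proved from any property the pulse shares with `C_T` — continuity, evenness,
`|C| ≤ C(0)`, decay to `0`, Laplace integrability, `A ≥ 0` (and positive type, unproved remark) — whatever the filter;
the proof of S5 must use an input specific to the chain that the pulse lacks (e.g. a bound on the number of
relaxation scales carrying unit anticorrelation area, an LAP at `ω = 0`, an eventual sign).  No new definitions.
Refuter seat refuter-cdisprove-stmt-AtomisticToContinuum-15384-0, 2026-08-17.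
-/

noncomputable section

namespace Summit.AtomisticToContinuum.FouriersLaw.Theorems.AbelRegularity.Negative

open MeasureTheory Set Filter Topology

/-- **The Abel means of the lacunary pulse oscillate** (named form): they neither converge in `ℝ` nor tend to `+∞`
as `ν ↓ 0` (`A(ρⁿ/16) ≥ 15/17`, `A(ρⁿ/4096) ≤ (1/8)(1−ρ)⁻¹ < 15/17`). [folklore] -/
theorem not_abelDichotomy_lacunaryPulse :
    ¬ ((∃ L : ℝ, Tendsto (fun ν : ℝ => ∫ t in Ioi (0:ℝ), Real.exp (-(ν * t)) *
          ∑' k : ℕ, (1 / 65536 : ℝ) ^ k * (Real.exp (-((1 / 65536 : ℝ) ^ k * |t|)) -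
            1 / 256 * Real.exp (-((1 / 65536 : ℝ) ^ k / 256 * |t|)))) (𝓝[>] 0) (𝓝 L)) ∨
        Tendsto (fun ν : ℝ => ∫ t in Ioi (0:ℝ), Real.exp (-(ν * t)) *
          ∑' k : ℕ, (1 / 65536 : ℝ) ^ k * (Real.exp (-((1 / 65536 : ℝ) ^ k * |t|)) -
            1 / 256 * Real.exp (-((1 / 65536 : ℝ) ^ k / 256 * |t|)))) (𝓝[>] 0) atTop) := by
  rintro (⟨L, hL⟩ | htop)
  · have hlo : (15 / 17 : ℝ) ≤ L :=
      ge_of_tendsto (hL.comp (tendsto_lacunaryScales_div 16 (by norm_num)))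
        (Eventually.of_forall fun n => abelMeans_lacunaryPulse_ge n)
    have hhi : L ≤ 1 / 8 * (1 - 1 / 65536 : ℝ)⁻¹ :=
      le_of_tendsto (hL.comp (tendsto_lacunaryScales_div 4096 (by norm_num)))
        (Eventually.of_forall fun n => abelMeans_lacunaryPulse_le n)
    norm_num at hhi
    linarith
  · obtain ⟨n, hn⟩ := ((htop.comp (tendsto_lacunaryScales_div 4096 (by norm_num))).eventually_ge_atTop 1).exists
    have h1 : (1 : ℝ) ≤ 1 / 8 * (1 - 1 / 65536 : ℝ)⁻¹ := hn.trans (abelMeans_lacunaryPulse_le n)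
    norm_num at h1

/-- **The lacunary pulse is not a tame filtered memory, for any causal filter** — the conclusion of the line's
physics stub S5 (`stub_tameFilteredMemory`) FAILS verbatim when `C_T` is replaced by the pulse: for every continuous
`ψ ≥ 0`, `U ≥ 0` with `∫_{[0,U]}ψ > 0`, the negative part of `F^ψ = ∫_{[0,U]}ψ(u)F(·+u)du` is not integrable on
`(0,∞)` and no iterated first moment `W_k[F^ψ]` keeps a weak sign on any `[t₀,∞)`.  Proof: the landed stubs S2
(`stub_filterTransfer`), S3 (`stub_abelOfIntegrableNegPart`), S4 (`stub_monotoneAbelOfSignedMoment`) composed as in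
`AbelRegularity_of` would give the Abel dichotomy for the pulse, refuted by `not_abelDichotomy_lacunaryPulse`. [folklore] -/
theorem lacunaryPulse_not_tame :
    ¬ ∃ (ψ : ℝ → ℝ) (U : ℝ), Continuous ψ ∧ 0 ≤ U ∧ (∀ u : ℝ, 0 ≤ ψ u) ∧ 0 < ∫ u in Icc (0:ℝ) U, ψ u ∧
      (IntegrableOn (fun t : ℝ => max (-(∫ u in Icc (0:ℝ) U, ψ u *
          ∑' k : ℕ, (1 / 65536 : ℝ) ^ k * (Real.exp (-((1 / 65536 : ℝ) ^ k * |t + u|)) -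
            1 / 256 * Real.exp (-((1 / 65536 : ℝ) ^ k / 256 * |t + u|))))) 0) (Ioi 0) ∨
        ∃ (k : ℕ) (t₀ : ℝ),
          (∀ t : ℝ, t₀ ≤ t → 0 ≤ ∫ s in (0:ℝ)..t, (t - s) ^ k * (s * ∫ u in Icc (0:ℝ) U, ψ u *
            ∑' k : ℕ, (1 / 65536 : ℝ) ^ k * (Real.exp (-((1 / 65536 : ℝ) ^ k * |s + u|)) -
              1 / 256 * Real.exp (-((1 / 65536 : ℝ) ^ k / 256 * |s + u|))))) ∨
          (∀ t : ℝ, t₀ ≤ t → ∫ s in (0:ℝ)..t, (t - s) ^ k * (s * ∫ u in Icc (0:ℝ) U, ψ u *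
            ∑' k : ℕ, (1 / 65536 : ℝ) ^ k * (Real.exp (-((1 / 65536 : ℝ) ^ k * |s + u|)) -
              1 / 256 * Real.exp (-((1 / 65536 : ℝ) ^ k / 256 * |s + u|)))) ≤ 0)) := by
  rintro ⟨ψ, U, hψ, hU, hψ0, hmass, htame⟩
  set F : ℝ → ℝ := fun t => ∑' k : ℕ, (1 / 65536 : ℝ) ^ k * (Real.exp (-((1 / 65536 : ℝ) ^ k * |t|)) -
    1 / 256 * Real.exp (-((1 / 65536 : ℝ) ^ k / 256 * |t|))) with hF
  have hc : Continuous F := continuous_lacunaryPulse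
  have hb : ∀ t : ℝ, |F t| ≤ F 0 := abs_lacunaryPulse_le
  have hA0 : ∀ ν : ℝ, 0 < ν → 0 ≤ ∫ t in Ioi (0:ℝ), Real.exp (-(ν * t)) * F t := fun ν hν =>
    abelMeans_lacunaryPulse_nonneg hν
  obtain ⟨hGc, hGb, hGlow, htransfer⟩ := Sketch.stub_filterTransfer F (F 0) ψ U hc hb hψ hU hψ0
  refine not_abelDichotomy_lacunaryPulse (htransfer hmass ?_)
  rcases htame with hneg | ⟨k, t₀, hsign⟩
  · exact Sketch.stub_abelOfIntegrableNegPart (fun t : ℝ => ∫ u in Icc (0:ℝ) U, ψ u * F (t + u)) _ hGc hGb hneg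
  · obtain ⟨b, hlow⟩ := hGlow hA0
    exact Sketch.stub_monotoneAbelOfSignedMoment (fun t : ℝ => ∫ u in Icc (0:ℝ) U, ψ u * F (t + u)) _ b t₀ k
      hGc hGb hlow hsign

/-- **The anticorrelation of the lacunary pulse has infinite area**: `F⁻ = max(−F, 0) ∉ L¹(0,∞)` (else the landed
S3 would give the dichotomy).  So S3's hypothesis genuinely fails on the failure profile, although `F → 0`. [folklore] -/
theorem lacunaryPulse_negPart_not_integrable :
    ¬ IntegrableOn (fun t : ℝ => max (-(∑' k : ℕ, (1 / 65536 : ℝ) ^ k *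
        (Real.exp (-((1 / 65536 : ℝ) ^ k * |t|)) - 1 / 256 * Real.exp (-((1 / 65536 : ℝ) ^ k / 256 * |t|))))) 0)
      (Ioi 0) := fun h =>
  not_abelDichotomy_lacunaryPulse (Sketch.stub_abelOfIntegrableNegPart _ _ continuous_lacunaryPulse
    abs_lacunaryPulse_le h)

/-- **Every iterated first moment of the (unfiltered) lacunary pulse changes sign beyond every `t₀`**: for all `k`
and `t₀` there are `t, t' ≥ t₀` with `W_k[F](t) < 0 < W_k[F](t')` (else the landed S4, with the lower bound `A ≥ 0`,
would give the dichotomy).  So S4's hypothesis fails on the failure profile for every `k`. [folklore] -/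
theorem lacunaryPulse_iteratedMoment_changes_sign (k : ℕ) (t₀ : ℝ) :
    (∃ t : ℝ, t₀ ≤ t ∧ ∫ s in (0:ℝ)..t, (t - s) ^ k * (s * ∑' j : ℕ, (1 / 65536 : ℝ) ^ j *
        (Real.exp (-((1 / 65536 : ℝ) ^ j * |s|)) - 1 / 256 * Real.exp (-((1 / 65536 : ℝ) ^ j / 256 * |s|)))) < 0) ∧
    (∃ t : ℝ, t₀ ≤ t ∧ 0 < ∫ s in (0:ℝ)..t, (t - s) ^ k * (s * ∑' j : ℕ, (1 / 65536 : ℝ) ^ j *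
        (Real.exp (-((1 / 65536 : ℝ) ^ j * |s|)) - 1 / 256 * Real.exp (-((1 / 65536 : ℝ) ^ j / 256 * |s|))))) := by
  have hS4 := Sketch.stub_monotoneAbelOfSignedMoment (fun s : ℝ => ∑' j : ℕ, (1 / 65536 : ℝ) ^ j *
      (Real.exp (-((1 / 65536 : ℝ) ^ j * |s|)) - 1 / 256 * Real.exp (-((1 / 65536 : ℝ) ^ j / 256 * |s|)))) _ 0 t₀ k
    continuous_lacunaryPulse abs_lacunaryPulse_le (fun ν hν _ => abelMeans_lacunaryPulse_nonneg hν)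
  by_contra h
  rcases not_and_or.1 h with h | h
  · exact not_abelDichotomy_lacunaryPulse (hS4 (Or.inl fun t ht => not_lt.1 fun hlt => h ⟨t, ht, hlt⟩))
  · exact not_abelDichotomy_lacunaryPulse (hS4 (Or.inr fun t ht => not_lt.1 fun hlt => h ⟨t, ht, hlt⟩))

end Summit.AtomisticToContinuum.FouriersLaw.Theorems.AbelRegularity.Negative

end
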